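import Summits.AtomisticToContinuum.Crystallization.Theorems.FrustratedLawDichotomyStrainedPatchHomValueT2SoundS

/-!
# (I1) part T — KIT BOOKKEEPING II for the joint value leaf (roadmap for `valueLeafT2J_sound`, step 5b): ★ `passP_spec` (the point tables `H`, `g`
# enclose any real label sums whose summands lie in the per-label tables), the masked entries of `hessOf`, the per-label CONTRIBUTIONS of `accLabel`
# (value-hull class: the exact double sum; Lipschitz class: a real lower bound of the triple loop — its inner `/SC` is a floor, charged `≤ w_m` per term),
# the box memberships along the segment `U_c + t(U − U_c)`, `ξ_c + t(ξ − ξ_c)`, the `A`-family displacement, and ★ the unpacking of the verdict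
# `valueLeafT2J μ c w = true` (27623 `(H) HomFloor`, hcp half; decomp-a2c hand-1 g49; critic row 1674 (B) (I1) docket).

No definitions; 0 sorry; standard axioms; no instances / notation / `#eval`.  `--supports stmt-AtomisticToContinuum-27623`.
-/

noncomputable section

namespace Summit.AtomisticToContinuum.Crystallization.Theorems.FrustratedLawDichotomyStrainedPatchHomValueT2Kit

open scoped BigOperators RealInnerProductSpace
open Finset
open Literature.Analysis.ValidatedNumerics.Numerics
open Summit.AtomisticToContinuum.Crystallization.Theorems.ChargedEnergyGapNegative (E3)
open Summit.AtomisticToContinuum.Crystallization.Theorems.FrustratedLawDichotomyStrainedPatchHomEntryGram (cen rad mem_entryFI)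
open Summit.AtomisticToContinuum.Crystallization.Theorems.FrustratedLawDichotomyStrainedPatchHomEntryGramHcp (shufFI mem_shufFI)
open Summit.AtomisticToContinuum.Crystallization.Theorems.FrustratedLawDichotomyStrainedPatchHomCurvCentreKit
  (boxE cenE cenX cenMap cenShuf zW cenMap_box cenShuf_box cenMap_entry cenShuf_apply)

/-! ## §1. ★ The point pass encloses real label sums -/

/-- ★★ **THE `passP` FOLD**: `ok = true` ⟹ every point record exists, and for any real summands lying in the per-label tables (Hessian entries, masked
for the `A` family; gradient entries) the label sums lie in the accumulated tables `H`, `g`. [formal bookkeeping: `foldl_pt_spec` twice] -/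
theorem passP_spec (c : (Fin 3 × Fin 3) ⊕ Fin 3 → ℤ) (LA LB : List (Fin 3 → ℤ)) (h : (passP c LA LB).ok = true) :
    (∀ b ∈ LA, ∃ R, mkDRec 6 (cenE c) (pA b) = some R) ∧ (∀ b ∈ LB, ∃ R, mkDRec 9 (cenE c) (qB (cenX c) b) = some R) ∧
    (∀ n, n < 81 → ∀ hA hB : (Fin 3 → ℤ) → ℝ,
      (∀ b ∈ LA, ∀ R, mkDRec 6 (cenE c) (pA b) = some R → FI.mem (hA b) ((hessOf R true).getD n fi0)) →
      (∀ b ∈ LB, ∀ R, mkDRec 9 (cenE c) (qB (cenX c) b) = some R → FI.mem (hB b) ((hessOf R false).getD n fi0)) →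
      FI.mem ((LA.map hA).sum + (LB.map hB).sum) ((passP c LA LB).H.getD n fi0)) ∧
    (∀ k, k < 9 → ∀ gA gB : (Fin 3 → ℤ) → ℝ,
      (∀ b ∈ LA, ∀ R, mkDRec 6 (cenE c) (pA b) = some R → FI.mem (gA b) (if true ∧ 6 ≤ k then fi0 else R.co.be.mul (R.z k))) →
      (∀ b ∈ LB, ∀ R, mkDRec 9 (cenE c) (qB (cenX c) b) = some R → FI.mem (gB b) (if false ∧ 6 ≤ k then fi0 else R.co.be.mul (R.z k))) →
      FI.mem ((LA.map gA).sum + (LB.map gB).sum) ((passP c LA LB).g.getD k fi0)) := by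
  have hpass : passP c LA LB = LB.foldl (fun A b =>
      match mkDRec 9 (cenE c) (qB (cenX c) b) with
      | none => (⟨false, A.H, A.g⟩ : PtData)
      | some R => ⟨A.ok, addArr 81 A.H (hessOf R false),
          addArr 9 A.g (Array.ofFn fun a : Fin 9 => if false ∧ 6 ≤ a.val then fi0 else R.co.be.mul (R.z a.val))⟩)
      (LA.foldl (fun A b =>
        match mkDRec 6 (cenE c) (pA b) with
        | none => (⟨false, A.H, A.g⟩ : PtData)
        | some R => ⟨A.ok, addArr 81 A.H (hessOf R true),
            addArr 9 A.g (Array.ofFn fun a : Fin 9 => if true ∧ 6 ≤ a.val then fi0 else R.co.be.mul (R.z a.val))⟩) ⟨true, zeroArr 81, zeroArr 9⟩) := by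
    unfold passP; rfl
  rw [hpass] at h ⊢
  obtain ⟨hokA, hallB, hHB, hgB⟩ := foldl_pt_spec LB (fun b => mkDRec 9 (cenE c) (qB (cenX c) b)) false _ h
  obtain ⟨_, hallA, hHA, hgA⟩ := foldl_pt_spec LA (fun b => mkDRec 6 (cenE c) (pA b)) true _ hokA
  refine ⟨hallA, hallB, fun n hn hA hB hmA hmB => ?_, fun k hk gA gB hmA hmB => ?_⟩
  · have h1 := hHA n hn hA 0 hmA (by rw [zeroArr_getD]; exact mem_fi0)
    rw [zero_add] at h1
    exact hHB n hn hB _ hmB h1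
  · have h1 := hgA k hk gA 0 hmA (by rw [zeroArr_getD]; exact mem_fi0)
    rw [zero_add] at h1
    exact hgB k hk gB _ hmB h1

/-- The masked entries of an `A`-family Hessian table are the zero interval. [formal bookkeeping] -/
theorem hessOf_masked (R : DRec) {k l : ℕ} (hk : k < 9) (hl : l < 9) (h : 6 ≤ k ∨ 6 ≤ l) : (hessOf R true).getD (9 * k + l) fi0 = fi0 := by
  unfold hessOf
  simp only
  rw [getD_ofFn_lt _ _ (by omega : 9 * k + l < 81)]
  have e1 : (9 * k + l) / 9 = k := by omega
  have e2 : (9 * k + l) % 9 = l := by omega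
  simp only [e1, e2]
  unfold sIx
  split_ifs with hkl
  · rw [getD_ofFn_lt _ _ (by omega : 9 * k + l < 81)]
    simp only [e1, e2]
    rw [if_pos (Or.inr ⟨trivial, h⟩)]
  · rw [getD_ofFn_lt _ _ (by omega : 9 * l + k < 81)]
    have e3 : (9 * l + k) / 9 = l := by omega
    have e4 : (9 * l + k) % 9 = k := by omega
    simp only [e3, e4]
    rw [if_pos (Or.inr ⟨trivial, h.symm⟩)]

/-! ## §2. The per-label contributions of `accLabel` -/

/-- Value-hull class: `pen6` contribution is `0`, `pen0` contribution is the exact double sum. [formal bookkeeping] -/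
theorem accLabel_contrib_hull (blk : ℕ → ℕ → Bool) (wf : Array ℤ) (Rb : DRec) (Hpt : Array FI) (maskX : Bool) (hl : Rb.co.lip = false) :
    (accLabel wJ blk wf Rb Hpt maskX ⟨true, 0, 0⟩).pen6 = 0 ∧
    (accLabel wJ blk wf Rb Hpt maskX ⟨true, 0, 0⟩).pen0 = ∑ a ∈ range 9, ∑ b ∈ range 9,
      (if blk a b then max |((hessOf Rb maskX).getD (9 * a + b) fi0).hi - (Hpt.getD (9 * a + b) fi0).lo|
          |(Hpt.getD (9 * a + b) fi0).hi - ((hessOf Rb maskX).getD (9 * a + b) fi0).lo| * wf.getD a 0 * wf.getD b 0 else 0) := by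
  unfold accLabel
  simp only [hl, Bool.false_eq_true, if_false]
  refine ⟨trivial, ?_⟩
  have inner : ∀ (a : ℕ) (s : ℤ), (List.range 9).foldl (fun s2 b =>
      if blk a b then
        s2 + max |((hessOf Rb maskX).getD (9 * a + b) fi0).hi - (Hpt.getD (9 * a + b) fi0).lo|
          |(Hpt.getD (9 * a + b) fi0).hi - ((hessOf Rb maskX).getD (9 * a + b) fi0).lo| * wf.getD a 0 * wf.getD b 0
      else s2) s =
      s + ∑ b ∈ range 9, (if blk a b then max |((hessOf Rb maskX).getD (9 * a + b) fi0).hi - (Hpt.getD (9 * a + b) fi0).lo|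
          |(Hpt.getD (9 * a + b) fi0).hi - ((hessOf Rb maskX).getD (9 * a + b) fi0).lo| * wf.getD a 0 * wf.getD b 0 else 0) := by
    intro a s
    rw [← foldl_add_range]
    congr 1
    funext s2 b
    split_ifs <;> simp
  simp only [inner, zero_add]
  rw [foldl_add_range, zero_add]

/-- Floor division loses less than one: `(x / d : ℤ) ≥ x/d − 1` over `ℝ` (`d > 0`). [arithmetic] -/
theorem fdiv_ge_sub_one {x d : ℤ} (hd : 0 < d) : (x : ℝ) / d - 1 ≤ ((x / d : ℤ) : ℝ) := by
  have h1 : x < (x / d + 1) * d := Int.lt_ediv_add_one_mul_self x hd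
  have hdR : (0 : ℝ) < d := by exact_mod_cast hd
  have h2 : (x : ℝ) < ((x / d : ℤ) + 1 : ℝ) * d := by exact_mod_cast h1
  rw [sub_le_iff_le_add, div_le_iff₀ hdR]
  linarith

/-- Lipschitz class: `pen0` contribution is `0` and ★ the `pen6` contribution (triple loop, sorted triples, inner floor division) is at least the exact sorted
sum minus one half-width per term. [formal bookkeeping + `fdiv_ge_sub_one`] -/
theorem accLabel_contrib_lip (blk : ℕ → ℕ → Bool) (wf : Array ℤ) (Rb : DRec) (Hpt : Array FI) (maskX : Bool) (hl : Rb.co.lip = true)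
    (hw : ∀ k, 0 ≤ wf.getD k 0) :
    (accLabel wJ blk wf Rb Hpt maskX ⟨true, 0, 0⟩).pen0 = 0 ∧
    ∑ a ∈ range (if maskX then 6 else 9), ∑ b ∈ range (if maskX then 6 else 9), ∑ m ∈ range (if maskX then 6 else 9),
        (if a ≤ b ∧ b ≤ m then ((wSym wJ a b m : ℤ) : ℝ) * ((thirdOf Rb a b m).absHi : ℝ) * (wf.getD a 0 : ℝ) * (wf.getD b 0 : ℝ) *
          (wf.getD m 0 : ℝ) / SC else 0) -
      ∑ _a ∈ range (if maskX then 6 else 9), ∑ _b ∈ range (if maskX then 6 else 9), ∑ m ∈ range (if maskX then 6 else 9), (wf.getD m 0 : ℝ) ≤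
      ((accLabel wJ blk wf Rb Hpt maskX ⟨true, 0, 0⟩).pen6 : ℝ) := by
  have hS : (0 : ℤ) < (SC : ℤ) := by exact_mod_cast (show 0 < SC by norm_num [SC])
  unfold accLabel
  simp only [hl, if_true]
  refine ⟨trivial, ?_⟩
  -- the three loops as sums
  have inner : ∀ (a b : ℕ) (s : ℤ), (List.range (if maskX then 6 else 9)).foldl (fun s3 m =>
      if m < b then s3 else
        let g := wSym wJ a b m
        if g = 0 then s3 else s3 + g * (thirdOf Rb a b m).absHi * wf.getD a 0 * wf.getD b 0 / (SC : ℤ) * wf.getD m 0) s =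
      s + ∑ m ∈ range (if maskX then 6 else 9), (if m < b then 0 else if wSym wJ a b m = 0 then 0 else
        wSym wJ a b m * (thirdOf Rb a b m).absHi * wf.getD a 0 * wf.getD b 0 / (SC : ℤ) * wf.getD m 0) := by
    intro a b s
    rw [← foldl_add_range]
    congr 1
    funext s3 m
    dsimp only
    split_ifs <;> simp
  have middle : ∀ (a : ℕ) (s : ℤ), (List.range (if maskX then 6 else 9)).foldl (fun s2 b =>
      if b < a then s2 else (List.range (if maskX then 6 else 9)).foldl (fun s3 m =>
        if m < b then s3 else
          let g := wSym wJ a b m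
          if g = 0 then s3 else s3 + g * (thirdOf Rb a b m).absHi * wf.getD a 0 * wf.getD b 0 / (SC : ℤ) * wf.getD m 0) s2) s =
      s + ∑ b ∈ range (if maskX then 6 else 9), (if b < a then 0 else ∑ m ∈ range (if maskX then 6 else 9),
        (if m < b then 0 else if wSym wJ a b m = 0 then 0 else
          wSym wJ a b m * (thirdOf Rb a b m).absHi * wf.getD a 0 * wf.getD b 0 / (SC : ℤ) * wf.getD m 0)) := by
    intro a s
    simp only [inner]
    rw [← foldl_add_range]
    congr 1
    funext s2 b
    split_ifs <;> simp
  simp only [middle]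
  rw [foldl_add_range]
  -- termwise comparison
  push_cast
  simp only [zero_add]
  rw [← Finset.sum_sub_distrib]
  refine Finset.sum_le_sum fun a _ => ?_
  rw [← Finset.sum_sub_distrib]
  refine Finset.sum_le_sum fun b _ => ?_
  have hwm : ∀ m, (0 : ℝ) ≤ (wf.getD m 0 : ℝ) := fun m => by exact_mod_cast hw m
  by_cases hba : b < a
  · simp only [hba, if_true]
    rw [← Finset.sum_sub_distrib]
    have : ∑ m ∈ range (if maskX then 6 else 9), ((if a ≤ b ∧ b ≤ m then ((wSym wJ a b m : ℤ) : ℝ) * ((thirdOf Rb a b m).absHi : ℝ) *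
        (wf.getD a 0 : ℝ) * (wf.getD b 0 : ℝ) * (wf.getD m 0 : ℝ) / SC else 0) - (wf.getD m 0 : ℝ)) ≤ 0 :=
      Finset.sum_nonpos fun m _ => by rw [if_neg (fun h => by omega)]; linarith [hwm m]
    simpa using this
  · simp only [hba, if_false]
    rw [← Finset.sum_sub_distrib]
    refine Finset.sum_le_sum fun m _ => ?_
    by_cases hmb : m < b
    · rw [if_neg (fun h => by omega), if_pos hmb]; linarith [hwm m]
    rw [if_neg hmb]
    by_cases hg : wSym wJ a b m = 0
    · rw [if_pos hg, hg]
      have e0 : (if a ≤ b ∧ b ≤ m then (((0 : ℤ) : ℤ) : ℝ) * ((thirdOf Rb a b m).absHi : ℝ) * (wf.getD a 0 : ℝ) * (wf.getD b 0 : ℝ) *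
          (wf.getD m 0 : ℝ) / SC else 0) = 0 := by split_ifs <;> simp
      rw [e0]; linarith [hwm m]
    rw [if_neg hg, if_pos ⟨by omega, by omega⟩]
    have hfl := fdiv_ge_sub_one (x := wSym wJ a b m * (thirdOf Rb a b m).absHi * wf.getD a 0 * wf.getD b 0) hS
    push_cast at hfl ⊢
    have key := mul_le_mul_of_nonneg_right hfl (hwm m)
    have e : ((wSym wJ a b m : ℤ) : ℝ) * ((thirdOf Rb a b m).absHi : ℝ) * (wf.getD a 0 : ℝ) * (wf.getD b 0 : ℝ) * (wf.getD m 0 : ℝ) / SC -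
        (wf.getD m 0 : ℝ) =
        (((wSym wJ a b m : ℤ) : ℝ) * ((thirdOf Rb a b m).absHi : ℝ) * (wf.getD a 0 : ℝ) * (wf.getD b 0 : ℝ) / SC - 1) * (wf.getD m 0 : ℝ) := by
      ring
    rw [e]; exact key

end Summit.AtomisticToContinuum.Crystallization.Theorems.FrustratedLawDichotomyStrainedPatchHomValueT2Kit
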